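import Literature.NumberTheory.Automorphic.ConstantTermBlockGLDerivatives
import Literature.NumberTheory.Automorphic.CuspFormArchConvolutionAutomorphy
import Literature.NumberTheory.Automorphic.HarishChandraConvolutionGLHolds
import HarnessLib

/-!
# The constant term of an automorphic form on `GL_n(𝔸_K)` along a maximal parabolic is smooth
# (Moeglin–Waldspurger 1995, I.2.6; Borel–Jacquet 1979, 4.4)

Topic `NumberTheory/Automorphic`; a sequel of `ConstantTermBlockGL` / `ConstantTermBlockGLDerivatives`
(the constant term `φ_P = blockCT (le_refl n) k ν φ` along the standard maximal parabolic `P_k` as a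
function on `GL_n(𝔸_K)`). Moeglin–Waldspurger I.2.6 lists "if `φ` is smooth then `φ_P` is smooth";
in the tree's chart-wise sense (`IsArchSmooth`: `X ↦ φ_P (g (exp X, 1))` is `C^∞` on `𝔤𝔩_n(K_∞)` for
every `g`) this is NOT a formal consequence of the commutation of the constant term with Lie
derivatives (`IsLeftInvariant.lieDeriv_blockCT`). We prove it for AUTOMORPHIC FORMS through
Harish-Chandra's convolution identity, which the tree proves for `GL_n`
(`AutomorphicRepsGL.exists_convolution_eq_self_holds`, `HarishChandraConvolutionGLHolds`;
Harish-Chandra 1966, Thm. 1; Borel–Jacquet 1979, 4.3): `φ = φ ∗ α̌` for some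
`α ∈ C_c^∞(GL_n(K_∞))`, so that `φ_P = (φ ∗ α̌)_P = φ_P ∗ α̌` is a right convolution of a continuous
function by a test function, hence smooth (Gårding; the tree's `isArchSmooth_archConv` of
`CuspFormArchConvolutionAutomorphy`):

* `IsLeftInvariant.blockCT_archConv` — **the constant term commutes with right convolution by
  `C_c(GL_n(K_∞))`**: `(φ ∗ α)_P = φ_P ∗ α` for `φ` continuous and left `GL_n(K)`-invariant (Fubini
  over Tate's box times `(supp α)⁻¹`; the joint integrand is bounded by periodicity and the relative
  compactness of the box — the computation of `cuspConditionGL_archConv`, kept as an identity);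
* `IsAutomorphicForm.isArchSmooth_blockCT` — **`φ_P` is smooth in the archimedean variable for every
  automorphic form `φ`** and every measure finite on compact sets on the box coordinates.

Everything here is proved: theorems only, no definition, no named fact.

## References

* C. Moeglin, J.-L. Waldspurger, *Spectral decomposition and Eisenstein series*, Cambridge Tracts
  in Math. 113 (1995), I.2.6 [MoeglinWaldspurger1995].
* A. Borel, H. Jacquet, *Automorphic forms and automorphic representations*, Proc. Sympos. Pure
  Math. 33 (Corvallis 1977), Part 1 (1979), 4.3–4.4 [BorelJacquet1979].
* Harish-Chandra, *Discrete series for semisimple Lie groups. II*, Acta Math. 116 (1966), Thm. 1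
  [HarishChandra1966].
-/

noncomputable section

open scoped MatrixGroups Matrix ContDiff Classical Topology
open NumberField NumberField.mixedEmbedding IsDedekindDomain Filter Set
open _root_.MeasureTheory _root_.MeasureTheory.Measure

namespace Literature.NumberTheory.Automorphic

-- the measurable structure of `GL_n(K_∞)` (the tree's local instances, as in
-- `HarishChandraConvolutionAdelic` and `CuspFormArchConvolution`)
attribute [local instance] glInfBorel borelSpace_glInf locallyCompactSpace_glInf
  secondCountableTopology_glInf

variable {K : Type} [Field K] [NumberField K]
  [MeasurableSpace (AdeleRing (𝓞 K) K)] [BorelSpace (AdeleRing (𝓞 K) K)] {n : ℕ}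

/-! ### 1. The constant term commutes with right convolution -/

section Conv

variable {k : ℕ} (ν : Measure (GL (Fin n) (mixedSpace K)))

/-- **The constant term commutes with right convolution by a test function on `GL_n(K_∞)`**:
for `φ : GL_n(𝔸_K) → ℂ` continuous and left `GL_n(K)`-invariant, `ν` σ-finite and finite on compact
sets on `GL_n(K_∞)`, `α ∈ C_c(GL_n(K_∞))` and `νD` finite on compact sets on the box coordinates of
`𝔫_k(𝔸_K)`, `(φ ∗ α)_P (g) = (φ_P ∗ α)(g)`, i.e.
`∫_D ∫ φ((1 + N) g y) α(y⁻¹) dν(y) dνD(N) = ∫ (∫_D φ((1 + N) g y) dνD(N)) α(y⁻¹) dν(y)`: the joint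
integrand is continuous, bounded (periodicity in `N`, relative compactness of Tate's box,
compactness of `supp α`) and supported in `D × (supp α)⁻¹` of finite measure, so Fubini applies.
Moeglin–Waldspurger 1995, I.2.6 (the constant term commutes with the right regular action);
Borel–Jacquet 1979, 4.4. [cite: MoeglinWaldspurger1995, I.2.6] -/
theorem IsLeftInvariant.blockCT_archConv [SigmaFinite ν] [IsFiniteMeasureOnCompacts ν]
    {φ : (AdelicGroupData.gl n K).Adelic → ℂ} (hleft : IsLeftInvariant (AdelicGroupData.gl n K) φ)
    (hφc : Continuous φ) {α : GL (Fin n) (mixedSpace K) → ℂ} (hαc : Continuous α)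
    (hαs : HasCompactSupport α) (νD : Measure (BlockIdx n k → AdeleRing (𝓞 K) K))
    [IsFiniteMeasureOnCompacts νD] (g : (AdelicGroupData.gl n K).Adelic) :
    blockCT (le_refl n) k νD (archConv ν α φ) g = archConv ν α (blockCT (le_refl n) k νD φ) g := by
  haveI := t2Space_adeleRing K
  haveI := secondCountableTopology_adeleRing K
  haveI : BorelSpace (BlockIdx n k → AdeleRing (𝓞 K) K) := Pi.borelSpace
  -- the unipotents in box coordinates, as elements of `G(𝔸_K)`
  set u : (BlockIdx n k → AdeleRing (𝓞 K) K) → (AdelicGroupData.gl n K).Adelic := fun N =>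
    unipotentOfBlock n k (AdeleRing (𝓞 K) K)
      (Multiplicative.ofAdd (blockMatrixEquiv (AdeleRing (𝓞 K) K) n k N)) with hu
  have huc : Continuous u :=
    continuous_unipotentOfBlock_ofAdd'.comp (continuous_blockMatrixEquiv n k)
  -- finiteness of the measure of the box
  set D : Set (BlockIdx n k → AdeleRing (𝓞 K) K) := piFundamentalDomain K (BlockIdx n k) with hD
  have hfin : νD D < ⊤ :=
    (measure_mono subset_closure).trans_lt
      (isCompact_closure_piFundamentalDomain K (BlockIdx n k)).measure_lt_top
  haveI : IsFiniteMeasure (νD.restrict D) := ⟨by rwa [Measure.restrict_apply_univ]⟩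
  -- the joint integrand
  set F : (BlockIdx n k → AdeleRing (𝓞 K) K) → GL (Fin n) (mixedSpace K) → ℂ := fun N y =>
    φ (u N * g * GLn.ofInfiniteAdelic n K y) * α y⁻¹ with hFdef
  have hF_eq : ∀ N, archConv ν α φ (u N * g) = ∫ y, F N y ∂ν := fun N => rfl
  -- continuity of the joint integrand
  have hcontφ : Continuous fun p : (BlockIdx n k → AdeleRing (𝓞 K) K) × GL (Fin n) (mixedSpace K) =>
      φ (u p.1 * g * GLn.ofInfiniteAdelic n K p.2) := by
    refine hφc.comp ?_
    exact ((huc.comp continuous_fst).mul continuous_const).mul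
      ((GLn.continuous_ofInfiniteAdelic n K).comp continuous_snd)
  have hcontF : Continuous (Function.uncurry F) :=
    hcontφ.mul ((hαc.comp continuous_inv).comp continuous_snd)
  -- a global bound: periodicity reduces to the compact `closure D × (supp α)⁻¹`
  set S : Set (GL (Fin n) (mixedSpace K)) := (tsupport α)⁻¹ with hSdef
  have hSc : IsCompact S := hαs.isCompact.inv
  obtain ⟨M, hM⟩ : ∃ M, ∀ p ∈ closure D ×ˢ S, ‖Function.uncurry F p‖ ≤ M :=
    ((isCompact_closure_piFundamentalDomain K (BlockIdx n k)).prod hSc).exists_bound_of_continuousOn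
      hcontF.continuousOn
  have hper : ∀ (d : BlockIdx n k → AdeleRing (𝓞 K) K) (ξ : BlockIdx n k → K)
      (y : GL (Fin n) (mixedSpace K)),
      F (d + fun i => algebraMap K (AdeleRing (𝓞 K) K) (ξ i)) y = F d y := by
    intro d ξ y
    have e : φ (u (d + fun i => algebraMap K (AdeleRing (𝓞 K) K) (ξ i)) *
        (g * GLn.ofInfiniteAdelic n K y)) = φ (u d * (g * GLn.ofInfiniteAdelic n K y)) :=
      hleft.apply_unipotentOfBlock_blockMatrixEquiv_add d ξ (g * GLn.ofInfiniteAdelic n K y)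
    simp only [hFdef, mul_assoc] at e ⊢
    rw [e]
  have hbound : ∀ N y, ‖F N y‖ ≤ max M 0 := by
    intro N y
    by_cases hy : y ∈ S
    · obtain ⟨γ, hγ, d, hd, rfl⟩ :=
        exists_mem_piPrincipalSubgroup_add_mem_piFundamentalDomain K (BlockIdx n k) N
      obtain ⟨ξ, hξ⟩ := (piPrincipalSubgroupEquiv K (BlockIdx n k)).surjective ⟨γ, hγ⟩
      have hγξ : γ = fun i => algebraMap K (AdeleRing (𝓞 K) K) (ξ i) := by
        have h := congrArg Subtype.val hξ
        rw [coe_piPrincipalSubgroupEquiv] at h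
        exact h.symm
      rw [hγξ, add_comm, hper d ξ y]
      exact (hM (d, y) ⟨subset_closure hd, hy⟩).trans (le_max_left _ _)
    · have hy' : y⁻¹ ∉ tsupport α := fun h => hy (by rw [hSdef, Set.mem_inv]; exact h)
      have : F N y = 0 := by
        simp only [hFdef, image_eq_zero_of_notMem_tsupport hy', mul_zero]
      rw [this, norm_zero]
      exact le_max_right _ _
  -- integrability on the product `(νD|_D) × ν`
  have hint : Integrable (Function.uncurry F) ((νD.restrict D).prod ν) := by
    have hsupp : ∀ p ∉ (Set.univ : Set (BlockIdx n k → AdeleRing (𝓞 K) K)) ×ˢ S,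
        Function.uncurry F p = 0 := by
      rintro ⟨N, y⟩ hp
      have hy : y ∉ S := fun hy => hp ⟨Set.mem_univ _, hy⟩
      have hy' : y⁻¹ ∉ tsupport α := fun h => hy (by rw [hSdef, Set.mem_inv]; exact h)
      simp only [Function.uncurry_apply_pair, hFdef, image_eq_zero_of_notMem_tsupport hy', mul_zero]
    refine IntegrableOn.integrable_of_forall_notMem_eq_zero ?_ hsupp
    refine Measure.integrableOn_of_bounded (M := max M 0) ?_ hcontF.aestronglyMeasurable ?_
    · rw [Measure.prod_prod, Measure.restrict_apply_univ]
      exact ENNReal.mul_ne_top hfin.ne hSc.measure_lt_top.ne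
    · exact Eventually.of_forall fun p => hbound p.1 p.2
  -- the constant terms of `φ` along the orbit, in the same coordinates
  have hG_eq : ∀ y : GL (Fin n) (mixedSpace K),
      blockCT (le_refl n) k νD φ (g * GLn.ofInfiniteAdelic n K y) =
        ∫ N in D, φ (u N * (g * GLn.ofInfiniteAdelic n K y)) ∂νD := fun y => by
    rw [blockCT_apply]
    simp_rw [glCorner_refl]
    rfl
  -- Fubini
  calc blockCT (le_refl n) k νD (archConv ν α φ) g
      = ∫ N in D, archConv ν α φ (u N * g) ∂νD := by
        rw [blockCT_apply]
        simp_rw [glCorner_refl]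
        rfl
    _ = ∫ N in D, ∫ y, F N y ∂ν ∂νD := by simp_rw [hF_eq]
    _ = ∫ y, ∫ N in D, F N y ∂νD ∂ν := integral_integral_swap hint
    _ = ∫ y, (∫ N in D, φ (u N * (g * GLn.ofInfiniteAdelic n K y)) ∂νD) * α y⁻¹ ∂ν := by
        refine integral_congr_ae (Eventually.of_forall fun y => ?_)
        simp only [hFdef, mul_assoc]
        exact integral_mul_const _ _
    _ = archConv ν α (blockCT (le_refl n) k νD φ) g := by
        rw [archConv_apply]
        refine integral_congr_ae (Eventually.of_forall fun y => ?_)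
        exact congrArg (fun z => z * α y⁻¹) (hG_eq y).symm

end Conv

/-! ### 2. Smoothness of the constant term of an automorphic form -/

section Smooth

variable {k : ℕ} {hcpt : isCompact_glFiniteIntegralLevel n K}

/-- **The constant term of an automorphic form along `P_k` is smooth in the archimedean
variable** (Moeglin–Waldspurger 1995, I.2.6: "if `φ` is smooth then `φ_P` is smooth"), for every
measure finite on compact sets on the box coordinates. Proof: by Harish-Chandra's convolution
identity (`AutomorphicRepsGL.exists_convolution_eq_self_holds`, with a Haar measure of `GL_n(K_∞)`)
`φ = φ ∗ α̌` for some `α ∈ C_c^∞(GL_n(K_∞))`; the constant term commutes with the convolution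
(`IsLeftInvariant.blockCT_archConv`), so `φ_P = φ_P ∗ α̌`, a right convolution of the continuous
function `φ_P` (`continuous_blockCT`) by a test function, which is smooth
(`isArchSmooth_archConv`). [cite: MoeglinWaldspurger1995, I.2.6] -/
theorem IsAutomorphicForm.isArchSmooth_blockCT {φ : (AdelicGroupData.gl n K).Adelic → ℂ}
    (hφ : IsAutomorphicForm (AutomorphyDatum.gl n K hcpt) φ)
    (νD : Measure (BlockIdx n k → AdeleRing (𝓞 K) K)) [IsFiniteMeasureOnCompacts νD] :
    IsArchSmooth (AutomorphyDatum.gl n K hcpt).ofArch (blockCT (le_refl n) k νD φ) := by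
  -- a Haar measure on `GL_n(K_∞)`
  set ν : Measure (GL (Fin n) (mixedSpace K)) := Measure.haar with hν
  have hφc : Continuous φ := hφ.continuous_gl
  -- Harish-Chandra: `φ = φ ∗ α̌`
  obtain ⟨α, hαc, hαs, hαsm, hαeq⟩ :=
    AutomorphicRepsGL.exists_convolution_eq_self_holds hcpt ν φ hφ
  set β : GL (Fin n) (mixedSpace K) → ℂ := fun x => α x⁻¹ with hβ
  have hβs : HasCompactSupport β := hαs.comp_homeomorph (Homeomorph.inv (GL (Fin n) (mixedSpace K)))
  have hβsm : IsArchSmooth (archGroupGL n K).carrier.subtype β := isArchSmooth_comp_inv_gl hαsm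
  have hβc : Continuous β := hαc.comp continuous_inv
  have hφconv : Automorphic.archConv ν β φ = φ := by
    funext g
    rw [hβ, archConv_comp_inv_apply]
    exact (hαeq g).symm
  -- hence `φ_P = φ_P ∗ α̌`
  have hCT : blockCT (le_refl n) k νD φ = Automorphic.archConv ν β (blockCT (le_refl n) k νD φ) := by
    funext g
    calc blockCT (le_refl n) k νD φ g = blockCT (le_refl n) k νD (Automorphic.archConv ν β φ) g := by
          rw [hφconv]
      _ = Automorphic.archConv ν β (blockCT (le_refl n) k νD φ) g :=
          hφ.leftInvariant.blockCT_archConv ν hφc hβc hβs νD g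
  rw [hCT]
  refine isArchSmooth_archConv ν (fun g => ?_) hβs hβsm
  exact (continuous_blockCT hφc νD).comp (continuous_const.mul (GLn.continuous_ofInfiniteAdelic n K))

end Smooth

end Literature.NumberTheory.Automorphic
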